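import Summits.BirchSwinnertonDyer.BirchSwinnertonDyer.Theorems.Rank2ShaTierKitW16P
import HarnessLib

/-!
# BirchSwinnertonDyer — rank-2 `Ш[3^∞]` cell: frame «w16-bound» at `p = 3` for rows with a RATIONAL
# POINT OF ORDER `3` (torsion `ℤ/3` or `ℤ/6`; torsion term `2·ord_3 #E(ℚ)_tors = 2` certified TWO-SIDED)

HONEST FRAMING (cell `b2b-bsdr2sha`, run/shared/lean/b2b/bsd-rank2-sha/): per-pair certified
theorems «cited hypotheses ∧ certified computation ⇒ `Ш(E/ℚ)[p^∞]` finite of order dividing `p^k`»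
for rank-2 curves at good ordinary primes; NO claim on BSD in rank `≥ 2`, no class-level theorem, every
published input is a NAMED HYPOTHESIS of the tree (nothing is asserted or minted here).

The `p = 3` w16 kits of the tree handle `3 ∤ #E(ℚ)_tors` (`Rank2ShaTierKitW16`, `checkW₃`) and an
observatory torsion certificate `TorsCert` (`Rank2ShaTierKitW16T`; kinds trivial, `ℤ/2`, `ℤ/3`, `ℤ/4`,
`ℤ/2 × ℤ/2` — no `ℤ/6`). This kit is the `p = 3` twin of `Rank2ShaTierKitW16P` (order-`5` point): the
exact torsion `3`-part `ord_3 #E(ℚ)_tors = 1` is decided TWO-SIDED in the kernel WITHOUT the full torsion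
structure — from below by a rational point `T` of order `3` (one tangent certificate `T + T = −T`), from
above by one good prime `ℓ ≥ 3` with `9 ∤ #Ẽ(𝔽_ℓ)` (`torsBoundCheck` of `Rank2ShaTierKitW16P`, sound by
`padicValNat_torsionOrder_le_one_of_torsBoundCheck`: `E(ℚ)_tors ↪ E(ℚ_ℓ)_tors`, `#E(ℚ_ℓ)_tors ∣ #Ẽ(𝔽_ℓ)`
at good `ℓ ≥ 3`, no named fact). So it covers the `ℤ/6` rows (and re-covers the `ℤ/3` rows).

* `threeTorsCheck e x y` — `T = (x, y)` integral on `e` with the tangent certificate `T + T = −T`;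
  `exists_addOrderOf_eq_three_of_threeTorsCheck`;
* `ShaRow.checkWP₃ := R.checkR₃ ∧ threeTorsCheck ∧ torsBoundCheck R.e 3 …` (slots: `T = (l₁ − sq₁, n₁ − n₂)`,
  `(ℓ, ⌊√ℓ⌋, #Ẽ(𝔽_ℓ)) = (sq₃, n₃, u)`; `red3Check` keeps its slots `(w₁, l₂, sq₂)`);
  `padicValNat_torsionOrder_eq_one_of_checkWP₃`;
* row theorems `ShaRow.w16P₃` (`ord_3 #Ш(E/ℚ)[3^∞] ≤ R.k + 2`), `ShaRow.w16P₃_eq_one` (`R.k + 2 ≤ 0 ⇒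
  Ш(E/ℚ)[3^∞] = 0`), READERS `ShaRow.booked_w16P₃One` (certificate `R.checkWP₃ = true ∧ R.k + 2 ≤ 0 ∧ 2 ≤ rank`)
  and `ShaRow.booked_w16P₃Le` — binders exactly those of `booked_w16One₃` (Wuthrich Thm. 16, PRS, ARS 2.6,
  an explicit lattice-optimal datum at level `≤ 130000`, the L-datum, THE canonical `3`-adic height datum).

References: C. Wuthrich, Doc. Math. 19 (2014), Thm. 16 [Wuthrich2014]; J. H. Silverman, *AEC* (2009),
III.2.3 (group law), VII.3.1(b) [SilvermanAEC2009]; A. Agashe, K. Ribet, W. Stein, *The Manin constant*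
(2006), Thm. 2.6 [AgasheRibetStein2006]; W. Stein, C. Wuthrich, Math. Comp. 82 (2013), Alg. 11.1
[SteinWuthrich2013]; J. Balakrishnan, J. S. Müller, W. Stein, Math. Comp. 85 (2016), Thm. 1.7
[BalakrishnanMullerStein2015].
-/

set_option autoImplicit false

-- single-conjunct summit: `Summit.BirchSwinnertonDyer.BirchSwinnertonDyer.…` repeats the name by design
set_option linter.dupNamespace false

noncomputable section

open scoped Classical MatrixGroups ModularForm

open CongruenceSubgroup WeierstrassCurve Literature.NumberTheory.EllipticCurves
  Literature.NumberTheory.EllipticCurves.ModularForms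
  Literature.NumberTheory.EllipticCurves.Rank1Residual
  Summit.BirchSwinnertonDyer.BirchSwinnertonDyer.Rank2Observatory

namespace Summit.BirchSwinnertonDyer.BirchSwinnertonDyer.Rank2Sha

/-! ## §1. A rational point of order `3` from one tangent certificate -/

/-- **Kernel certificate of a rational point of order `3`** on an integer model: `T = (x, y)` an integral
point with the tangent certificate `T + T = (x, −y − a₁x − a₃) = −T` (equivalently `ψ₃(x) = 0`).
[cite: SilvermanAEC2009, III.2.3] -/
def threeTorsCheck (e : WeierstrassCurve ℤ) (x y : ℤ) : Bool :=
  onCurveZ e x y && intTangent e x y x (-y - e.a₁ * x - e.a₃)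

/-- **A point of order exactly `3`** from the certificate: `2T = −T`, so `3T = 0`, `T ≠ 0`, and `3` is
prime. [cite: SilvermanAEC2009, III.2.3] -/
theorem exists_addOrderOf_eq_three_of_threeTorsCheck {e : WeierstrassCurve ℤ} {x y : ℤ}
    (hΔ : e.Δ ≠ 0) (h : threeTorsCheck e x y = true) :
    ∃ T : (e.map (Int.castRingHom ℚ)).toAffine.Point, addOrderOf T = 3 := by
  simp only [threeTorsCheck, Bool.and_eq_true] at h
  obtain ⟨h₁, ht⟩ := h
  have h₁' := onCurveZ_spec e h₁
  have hneg : (-y - e.a₁ * x - e.a₃) ^ 2 + e.a₁ * x * (-y - e.a₁ * x - e.a₃) +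
      e.a₃ * (-y - e.a₁ * x - e.a₃) = x ^ 3 + e.a₂ * x ^ 2 + e.a₄ * x + e.a₆ := by
    linear_combination h₁'
  haveI := isElliptic_rat e hΔ
  haveI : Fact (Nat.Prime 3) := ⟨by norm_num⟩
  set T : (e.map (Int.castRingHom ℚ)).toAffine.Point :=
    .some _ _ (nonsingular_rat_of_eq e hΔ h₁') with hT
  have hdbl := some_add_self_of_intTangent e hΔ h₁' hneg ht
  have hnegT : -T = .some ((x : ℤ) : ℚ) ((-y - e.a₁ * x - e.a₃ : ℤ) : ℚ)
      (nonsingular_rat_of_eq e hΔ hneg) := by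
    rw [hT, Affine.Point.neg_some]
    congr 1
    simp only [Affine.negY, WeierstrassCurve.map, eq_intCast]
    push_cast; ring
  have h2 : (2 : ℕ) • T = -T := by rw [two_nsmul, hnegT]; exact hdbl
  have h3 : (3 : ℕ) • T = 0 := by
    rw [show (3 : ℕ) = 2 + 1 from rfl, add_nsmul, h2, one_nsmul, neg_add_cancel]
  exact ⟨T, addOrderOf_eq_prime h3 (Affine.Point.some_ne_zero _)⟩

/-! ## §2. The compact row of frame «w16-bound» at `p = 3` with a point of order `3` -/

namespace ShaRow

variable (R : ShaRow)

/-- **The kernel test of a `p = 3` row with a RATIONAL POINT OF ORDER `3`**: `checkR₃` (the `p = 3` base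
test + reducible `E[3]`), the order-`3` certificate `threeTorsCheck` read in the slots `T = (l₁ − sq₁, n₁ − n₂)`
of `R.sw`, and the torsion bound `torsBoundCheck R.e 3` (one good `ℓ ≥ 3` with `9 ∤ #Ẽ(𝔽_ℓ)`) in the slots
`(sq₃, n₃, u)`. [cite: Wuthrich2014, Thm. 16 (p. 397)] [cite: SilvermanAEC2009, III.2.3 and VII.3.1(b)] -/
def checkWP₃ : Bool :=
  R.checkR₃ &&
    threeTorsCheck R.e ((R.sw.l₁ : ℤ) - R.sw.sq₁) ((R.sw.n₁ : ℤ) - R.sw.n₂) &&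
    torsBoundCheck R.e 3 R.sw.sq₃ R.sw.n₃ R.sw.u

variable {R}

/-- A row passing `checkWP₃` passes `checkR₃`. [folklore] -/
theorem checkR₃_of_checkWP₃ (h : R.checkWP₃ = true) : R.checkR₃ = true := by
  simp only [checkWP₃, Bool.and_eq_true] at h; exact h.1.1

/-- Unpacking a passing `checkWP₃`. [folklore] -/
theorem checkWP₃_spec (h : R.checkWP₃ = true) :
    R.checkR₃ = true ∧
      threeTorsCheck R.e ((R.sw.l₁ : ℤ) - R.sw.sq₁) ((R.sw.n₁ : ℤ) - R.sw.n₂) = true ∧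
      torsBoundCheck R.e 3 R.sw.sq₃ R.sw.n₃ R.sw.u = true := by
  simp only [checkWP₃, Bool.and_eq_true] at h
  exact ⟨h.1.1, h.1.2, h.2⟩

/-- From a tier theorem `rows.all checkWP₃ = true` to the test of a member. [folklore] -/
theorem checkWP₃_of_all {rows : List ShaRow} (hall : rows.all ShaRow.checkWP₃ = true) {R : ShaRow}
    (hmem : R ∈ rows) : R.checkWP₃ = true :=
  List.all_eq_true.mp hall R hmem

/-- **At a row passing `checkWP₃`: `ord_3 #E(ℚ)_tors = 1` exactly** (two-sided: `3 ∣ #E(ℚ)_tors` from the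
point of order `3`, `9 ∤ #E(ℚ)_tors` from the good prime). [cite: SilvermanAEC2009, VII.3.1(b)] -/
theorem padicValNat_torsionOrder_eq_one_of_checkWP₃ (h : R.checkWP₃ = true)
    [(R.e.baseChange ℚ).IsElliptic] [(R.e.baseChange ℚ).IsGloballyMinimal] :
    padicValNat 3 (R.e.baseChange ℚ).torsionOrder = 1 := by
  obtain ⟨hc, ht, hb⟩ := checkWP₃_spec h
  haveI : Fact (Nat.Prime 3) := ⟨by norm_num⟩
  have hΔ : R.e.Δ ≠ 0 := fun h0 =>
    (check₃_spec (check₃_of_checkR₃ hc)).2.1 (by rw [h0]; exact dvd_zero _)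
  obtain ⟨T₀, hT₀⟩ := exists_addOrderOf_eq_three_of_threeTorsCheck hΔ ht
  -- the same point on `R.e ⊗ ℚ` (`baseChange ℚ = map (algebraMap ℤ ℚ)`, definitionally `map (Int.castRingHom ℚ)`)
  let T : (R.e.baseChange ℚ).toAffine.Point := T₀
  have hT' : addOrderOf T = 3 := hT₀
  refine le_antisymm (padicValNat_torsionOrder_le_one_of_torsBoundCheck hb) ?_
  have hfin : IsOfFinAddOrder T := addOrderOf_pos_iff.mp (by rw [hT']; norm_num)
  have hdvd : 3 ∣ (R.e.baseChange ℚ).torsionOrder := by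
    rw [torsionOrder_eq_natCard, ← hT']
    have := addOrderOf_dvd_natCard (⟨T, (AddCommGroup.mem_torsion _).mpr hfin⟩ :
      AddCommGroup.torsion (R.e.baseChange ℚ).toAffine.Point)
    rwa [AddSubgroup.addOrderOf_mk] at this
  have h0 : (R.e.baseChange ℚ).torsionOrder ≠ 0 :=
    ((R.e.baseChange ℚ).torsionOrder_pos_holds).ne'
  exact (padicValNat_dvd_iff_le h0).mp (by rw [pow_one]; exact hdvd)

/-! ## §3. The row theorems and readers -/

/-- **TIER ROW THEOREM at `p = 3`, frame «w16-bound», rational point of order `3`.** For a compact row `R`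
passing `checkWP₃` (kernel: `p = 3` good ordinary, minimal model, exact Tamagawa certificate, `E[3]`
reducible, `ord_3 #E(ℚ)_tors = 1` two-sided), GIVEN `hW16` (Wuthrich 2014 Thm. 16), `hS` (PRS), `h26`
(Agashe–Ribet–Stein Thm. 2.6), an EXPLICIT lattice-optimal parametrisation datum at a level `N ≤ 130000`, the
rank certificate, the L-datum and THE canonical `3`-adic height datum: `rank_ℤ E(ℚ) = 2`, `Ш(E/ℚ)[3^∞]`
finite, `Reg_3 ≠ 0`, `ord_3 #Ш(E/ℚ)[3^∞] ≤ R.k + 2`. Per pair; NOT a class theorem.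
[cite: Wuthrich2014, Thm. 16 (p. 397)] [cite: AgasheRibetStein2006, Thm. 2.6]
[cite: BalakrishnanMullerStein2015, Thm. 1.7] [cite: SteinWuthrich2013, §§3–4 and Alg. 11.1] -/
theorem w16P₃ (h : R.checkWP₃ = true) [(R.e.baseChange ℚ).IsElliptic] [(R.e.baseChange ℚ).IsGloballyMinimal]
    (hW16 : Wuthrich2014.charIdeal_dvd_padicLFunction) (hS : Schneider1985_order_charGenerator_odd)
    (h26 : AgasheRibetStein2006.cremona_abs_maninConstant_eq_one_of_level_le)
    {N : ℕ} [NeZero N] (D : ModularParametrizationData (R.e.baseChange ℚ) N)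
    (hopt : ∀ z ∈ D.L.lattice, ∃ w ∈ periodLattice D.f, z = D.c * w) (hN : N ≤ 130000)
    (hlow : 2 ≤ (R.e.baseChange ℚ).mordellWeilRank)
    (hLp : PowerSeries.coeff 2 (padicLFunction D.f (unitRoot (R.e.baseChange ℚ) 3 : ℚ_[3])) ≠ 0)
    (hcoeff : (PowerSeries.coeff 2
      (padicLFunction D.f (unitRoot (R.e.baseChange ℚ) 3 : ℚ_[3]))).valuation = R.a)
    (Dh : PAdicHeightData (R.e.baseChange ℚ) 3) (hDh : Dh.IsCanonical)
    (hreg : (padicRegulator Dh).valuation = R.b) :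
    (R.e.baseChange ℚ).mordellWeilRank = 2 ∧
      Finite (AddCommGroup.primaryComponent (R.e.baseChange ℚ).sha 3) ∧ SchneiderConjecture Dh ∧
      (padicValNat 3 (Nat.card (AddCommGroup.primaryComponent (R.e.baseChange ℚ).sha 3)) : ℤ) ≤
        R.k + 2 := by
  have hR := checkR₃_of_checkWP₃ h
  have hb := check₃_of_checkR₃ hR
  have hordin := isOrdinaryAt₃ hb
  have hred := not_irr_of_checkR₃ hR
  obtain ⟨hr, hfin, hSch, hle⟩ := padicBSD_inequality_of_wuthrich16_odd_of_coeff_ne_zero_of_optimal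
    hW16 hS h26 (R.e.baseChange ℚ) 3 (by decide) hordin.1 hordin.2 hred D hopt hN Dh hDh hlow hLp
  haveI := hfin
  refine ⟨hr, hfin, hSch, ?_⟩
  have hk := padicValNat_card_shaPrimary_le_of_valuation_le (R.e.baseChange ℚ) 3 (by decide) hordin D.f
    Dh hSch hLp hle hcoeff hreg
  rw [padicValNat_torsionOrder_eq_one_of_checkWP₃ h, (reductionPointCount_eq_and_tamagawaProduct_eq₃ hb).1,
    (reductionPointCount_eq_and_tamagawaProduct_eq₃ hb).2] at hk
  rw [ShaRow.k, p_eq_three hb]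
  push_cast at hk ⊢
  linarith

/-- **`p = 3`, frame «w16-bound» with a point of order `3`, `R.k + 2 ≤ 0`: `Ш(E/ℚ)[3^∞] = 0`.**
[cite: Wuthrich2014, Thm. 16 (p. 397)] [cite: SteinWuthrich2013, Thm. 1.1 and Alg. 11.1] -/
theorem w16P₃_eq_one (h : R.checkWP₃ = true) [(R.e.baseChange ℚ).IsElliptic]
    [(R.e.baseChange ℚ).IsGloballyMinimal]
    (hW16 : Wuthrich2014.charIdeal_dvd_padicLFunction) (hS : Schneider1985_order_charGenerator_odd)
    (h26 : AgasheRibetStein2006.cremona_abs_maninConstant_eq_one_of_level_le)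
    {N : ℕ} [NeZero N] (D : ModularParametrizationData (R.e.baseChange ℚ) N)
    (hopt : ∀ z ∈ D.L.lattice, ∃ w ∈ periodLattice D.f, z = D.c * w) (hN : N ≤ 130000)
    (hlow : 2 ≤ (R.e.baseChange ℚ).mordellWeilRank)
    (hLp : PowerSeries.coeff 2 (padicLFunction D.f (unitRoot (R.e.baseChange ℚ) 3 : ℚ_[3])) ≠ 0)
    (hcoeff : (PowerSeries.coeff 2
      (padicLFunction D.f (unitRoot (R.e.baseChange ℚ) 3 : ℚ_[3]))).valuation = R.a)
    (Dh : PAdicHeightData (R.e.baseChange ℚ) 3) (hDh : Dh.IsCanonical)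
    (hreg : (padicRegulator Dh).valuation = R.b) (hk0 : R.k + 2 ≤ 0) :
    (R.e.baseChange ℚ).mordellWeilRank = 2 ∧
      Finite (AddCommGroup.primaryComponent (R.e.baseChange ℚ).sha 3) ∧ SchneiderConjecture Dh ∧
      Nat.card (AddCommGroup.primaryComponent (R.e.baseChange ℚ).sha 3) = 1 := by
  obtain ⟨hr, hfin, hSch, hle⟩ := w16P₃ h hW16 hS h26 D hopt hN hlow hLp hcoeff Dh hDh hreg
  haveI := hfin
  have hv0 : padicValNat 3 (Nat.card (AddCommGroup.primaryComponent (R.e.baseChange ℚ).sha 3)) = 0 := by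
    have := hle.trans hk0
    omega
  have hndvd : ¬ 3 ∣ Nat.card (AddCommGroup.primaryComponent (R.e.baseChange ℚ).sha 3) := by
    rcases padicValNat.eq_zero_iff.mp hv0 with h1 | h0 | hnd
    · exact absurd h1 (by decide)
    · exact absurd h0 Nat.card_pos.ne'
    · exact hnd
  exact ⟨hr, hfin, hSch, natCard_primaryComponent_eq_one 3 hndvd⟩

/-- **READER at `p = 3`, frame «w16-bound» with a point of order `3`, V-BOUND 0** («`Ш(E/ℚ)[3^∞] = 0`»):
certificate `R.checkWP₃ = true ∧ R.k + 2 ≤ 0 ∧ 2 ≤ rank`. [cite: Wuthrich2014, Thm. 16 (p. 397)]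
[cite: AgasheRibetStein2006, Thm. 2.6] [cite: SteinWuthrich2013, Alg. 11.1 and Prop. 11.2] -/
theorem booked_w16P₃One (h : R.checkWP₃ = true ∧ R.k + 2 ≤ 0 ∧ 2 ≤ (R.e.baseChange ℚ).mordellWeilRank) :
    haveI := (isElliptic_and_isGloballyMinimal₃ (check₃_of_checkR₃ (checkR₃_of_checkWP₃ h.1))).1
    haveI := (isElliptic_and_isGloballyMinimal₃ (check₃_of_checkR₃ (checkR₃_of_checkWP₃ h.1))).2
    ∀ (_hW16 : Wuthrich2014.charIdeal_dvd_padicLFunction) (_hS : Schneider1985_order_charGenerator_odd)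
      (_h26 : AgasheRibetStein2006.cremona_abs_maninConstant_eq_one_of_level_le)
      {N : ℕ} [NeZero N] (D : ModularParametrizationData (R.e.baseChange ℚ) N)
      (_hopt : ∀ z ∈ D.L.lattice, ∃ w ∈ periodLattice D.f, z = D.c * w) (_hN : N ≤ 130000)
      (_hLp : PowerSeries.coeff 2 (padicLFunction D.f (unitRoot (R.e.baseChange ℚ) 3 : ℚ_[3])) ≠ 0)
      (_hcoeff : (PowerSeries.coeff 2
        (padicLFunction D.f (unitRoot (R.e.baseChange ℚ) 3 : ℚ_[3]))).valuation = R.a)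
      (Dh : PAdicHeightData (R.e.baseChange ℚ) 3) (_hDh : Dh.IsCanonical)
      (_hreg : (padicRegulator Dh).valuation = R.b),
      (R.e.baseChange ℚ).mordellWeilRank = 2 ∧
        Finite (AddCommGroup.primaryComponent (R.e.baseChange ℚ).sha 3) ∧ SchneiderConjecture Dh ∧
        Nat.card (AddCommGroup.primaryComponent (R.e.baseChange ℚ).sha 3) = 1 := by
  intro hW16 hS h26 N _ D hopt hN hLp hcoeff Dh hDh hreg
  haveI := (isElliptic_and_isGloballyMinimal₃ (check₃_of_checkR₃ (checkR₃_of_checkWP₃ h.1))).1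
  haveI := (isElliptic_and_isGloballyMinimal₃ (check₃_of_checkR₃ (checkR₃_of_checkWP₃ h.1))).2
  exact w16P₃_eq_one h.1 hW16 hS h26 D hopt hN h.2.2 hLp hcoeff Dh hDh hreg h.2.1

/-- **READER at `p = 3`, frame «w16-bound» with a point of order `3`, V-BOUND `b`**: certificate
`R.checkWP₃ = true ∧ 2 ≤ rank`; conclusion `ord_3 #Ш(E/ℚ)[3^∞] ≤ R.k + 2`. [cite: Wuthrich2014, Thm. 16 (p. 397)]
[cite: AgasheRibetStein2006, Thm. 2.6] [cite: SteinWuthrich2013, Alg. 11.1 and Prop. 11.2] -/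
theorem booked_w16P₃Le (h : R.checkWP₃ = true ∧ 2 ≤ (R.e.baseChange ℚ).mordellWeilRank) :
    haveI := (isElliptic_and_isGloballyMinimal₃ (check₃_of_checkR₃ (checkR₃_of_checkWP₃ h.1))).1
    haveI := (isElliptic_and_isGloballyMinimal₃ (check₃_of_checkR₃ (checkR₃_of_checkWP₃ h.1))).2
    ∀ (_hW16 : Wuthrich2014.charIdeal_dvd_padicLFunction) (_hS : Schneider1985_order_charGenerator_odd)
      (_h26 : AgasheRibetStein2006.cremona_abs_maninConstant_eq_one_of_level_le)
      {N : ℕ} [NeZero N] (D : ModularParametrizationData (R.e.baseChange ℚ) N)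
      (_hopt : ∀ z ∈ D.L.lattice, ∃ w ∈ periodLattice D.f, z = D.c * w) (_hN : N ≤ 130000)
      (_hLp : PowerSeries.coeff 2 (padicLFunction D.f (unitRoot (R.e.baseChange ℚ) 3 : ℚ_[3])) ≠ 0)
      (_hcoeff : (PowerSeries.coeff 2
        (padicLFunction D.f (unitRoot (R.e.baseChange ℚ) 3 : ℚ_[3]))).valuation = R.a)
      (Dh : PAdicHeightData (R.e.baseChange ℚ) 3) (_hDh : Dh.IsCanonical)
      (_hreg : (padicRegulator Dh).valuation = R.b),
      (R.e.baseChange ℚ).mordellWeilRank = 2 ∧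
        Finite (AddCommGroup.primaryComponent (R.e.baseChange ℚ).sha 3) ∧ SchneiderConjecture Dh ∧
        (padicValNat 3 (Nat.card (AddCommGroup.primaryComponent (R.e.baseChange ℚ).sha 3)) : ℤ) ≤
          R.k + 2 := by
  intro hW16 hS h26 N _ D hopt hN hLp hcoeff Dh hDh hreg
  haveI := (isElliptic_and_isGloballyMinimal₃ (check₃_of_checkR₃ (checkR₃_of_checkWP₃ h.1))).1
  haveI := (isElliptic_and_isGloballyMinimal₃ (check₃_of_checkR₃ (checkR₃_of_checkWP₃ h.1))).2
  exact w16P₃ h.1 hW16 hS h26 D hopt hN h.2 hLp hcoeff Dh hDh hreg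

end ShaRow

end Summit.BirchSwinnertonDyer.BirchSwinnertonDyer.Rank2Sha

end
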